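import Summits.BirchSwinnertonDyer.BirchSwinnertonDyer.Theorems.SemiOrdinaryEisensteinDescentWildKolyvaginUpperAtThreeTowerFreeBeyondMax
import Summits.BirchSwinnertonDyer.BirchSwinnertonDyer.Theorems.SemiOrdinaryEisensteinDescentWildKolyvaginUpperAtThreeTowerFreeJetchevMaxModThree
import HarnessLib

/-!
# Route `SemiOrdinaryEisensteinDescent` (rev 18, act G), research crux J‴ `WildSigmaDivisibilityAtThreeMultiCarrier`
# (stmt-BirchSwinnertonDyer-25898): **J‴ BY NAME ⟺ the depth residue J⁗, modulo Jetchev's max-form** — so the crux of record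
# is, in the kernel, exactly «`3^{s′} ∣ P(n)` for `max_q ord₃ c_q < s′ ≤ Σ_q ord₃ c_q + v₃ c`» (⊕ Manin₃ after scaling)
# (cell `bsd-wall`, width seat `bsd-wall-soed-p2-w3` gen 2; `--supports stmt-BirchSwinnertonDyer-25898`, helper; BSD is not proved by this file)

Act G (pen pss3x g3, SOED rev 16–18) re-keyed the Kolyvagin branch of the deciding chain to
`KolyvaginPrimitivesAtThree` (print) ∧ `JetchevMaxDivisibilityAtThreeModThree` (tree debt; = hJmax ⟸ PT, E0, 3.7 (2), PROVED by
w2 g5's p606426 `jetchevMaxModThree_of_literature`) ∧ **J‴ `WildSigmaDivisibilityAtThreeMultiCarrier`** (research: J′'s text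
restricted to MULTI-CARRIER FRAMES `∀ q ∣ N, ord₃ c_q < t`). This seat's p606966 (`…TowerFreeBeyondMax`) introduced the DEPTH
form J⁗ (J′'s text + ONE binder «every single carrier `ord₃ c_q < s′`») and proved J‴ ⟹ J⁗ (`beyondMax_of_sigmaMultiCarrier`).
This file proves the converse modulo Jetchev's max: **J‴ BY NAME ⟸ hJmax + J⁗** (on a multi-carrier frame, a depth reached by
some single carrier is Jetchev's; a depth beyond every carrier is J⁗'s), discharges hJmax by p606426, and threads the Manin
scaling of p606966 §2. Upshot for the vet / disprover / any prover of 25898: the item is EQUIVALENT, modulo the print facts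
{PT, E0, 3.7 (2)}, to the half-open depth window (max, Σ] — Jetchev 2008 Thm. 1.4 vs. Conj. 1.3, i.e. Büyükboduk 2009 §4.2
Question 1 at the additive prime `3` (plus the Manin₃ shadow, removable by ManinScaling₃) — and contains no instance that print
already closes once hJmax is fed.

WHAT IS PROVED (no definition, no named fact, no `sorry`; CONDITIONAL on the displayed hypotheses; nothing asserted about any curve):
* `wildSigmaDivisibilityAtThreeMultiCarrier_of_beyondMax_of_jetchevMax : hJmax → J⁗ → J‴` (J‴ BY NAME);
* `beyondMax_of_wildSigmaDivisibilityAtThreeMultiCarrier : J‴ → J⁗` (BY NAME; = p606966's `beyondMax_of_sigmaMultiCarrier`);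
* `wildSigmaDivisibilityAtThreeMultiCarrier_of_beyondMax_of_threePrintFacts : PT → E0 → 3.7 (2) → J⁗ → J‴`;
* `wildSigmaDivisibilityAtThreeMultiCarrier_of_flatBeyondMax_of_maninScaling_of_threePrintFacts :
   PT → E0 → 3.7 (2) → J⁗♭ → ManinScaling₃ → J‴`.

References: [Jetchev2008] Thm. 1.4, Cor. 1.5, Conj. 1.3 (p. 812); [Buyukboduk2009TamagawaDefect] §4.2 Question 1; [GrossLMS1991]
Prop. 3.7 (2), §6; [Cha2005] Thm. 3, 7; [CesnaviciusNeururerSaha2023] Thm. 1.2.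
-/

set_option autoImplicit false
set_option linter.dupNamespace false -- `Summit.BirchSwinnertonDyer.BirchSwinnertonDyer.…` is the tree's layout (D-0017)

noncomputable section

open scoped Classical

namespace Summit.BirchSwinnertonDyer.BirchSwinnertonDyer.Theorems.WildSigmaDivisibilityAtThreeMultiCarrierOfBeyondMax

open WeierstrassCurve NumberField Literature.NumberTheory.EllipticCurves
  Literature.NumberTheory.EllipticCurves.ModularForms
  Literature.NumberTheory.GaloisCohomology
  Summit.BirchSwinnertonDyer.Rank1Residual
  Summit.BirchSwinnertonDyer.Rank1Residual.Additive
  Summit.BirchSwinnertonDyer.Rank1Residual.X11b.Three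
  Summit.BirchSwinnertonDyer.BirchSwinnertonDyer.Theses.SemiOrdinaryEisensteinDescent
  Summit.BirchSwinnertonDyer.BirchSwinnertonDyer.Theorems.WildKolyvaginUpperAtThreeTowerFreeBeyondMax
  Summit.BirchSwinnertonDyer.BirchSwinnertonDyer.Theorems.WildKolyvaginUpperAtThreeTowerFreeJetchevMaxModThree
open Literature.NumberTheory.EllipticCurves.GrossLMS1991 (prop37_2_frobeniusCongruence)

/-- **J‴ `WildSigmaDivisibilityAtThreeMultiCarrier` (stmt-25898) BY NAME ⟸ Jetchev's max-form mod `3` (`hJmax`, displayed as in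
p598295 §2 / item 25897's consequent) + the depth residue J⁗ (`hJb`: J′'s text + ONE binder «`∀ q` prime `∣ N, ord₃ c_q < s′`»).**
On a multi-carrier frame at depth `s′ ≤ t`: if some prime `q₀ ∣ N` has `s′ ≤ ord₃ c_{q₀}`, `hJmax` at `q₀`; otherwise every
carrier is `< s′` and `hJb` applies (the multi-carrier hypothesis is not even used — J⁗ is frame-blind). With p606966's
`beyondMax_of_sigmaMultiCarrier` (J‴ ⟹ J⁗) this makes J‴ and J⁗ EQUIVALENT modulo `hJmax`. CONDITIONAL on both hypotheses;
nothing asserted. [cite: Jetchev2008, Thm. 1.4 and Conj. 1.3 (p. 812)] [cite: Buyukboduk2009TamagawaDefect, §4.2 Question 1] -/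
theorem wildSigmaDivisibilityAtThreeMultiCarrier_of_beyondMax_of_jetchevMax
    (hJmax : ∀ (W : WeierstrassCurve ℚ) [W.IsElliptic] [W.IsGloballyMinimal] (N : ℕ) [NeZero N] (K : Type)
      [Field K] [NumberField K] (Dt : ModularParametrizationData W N)
      (H : HeegnerDatum N (NumberField.discr K)) (ι : K →+* ℂ) (P : (W.baseChange K).toAffine.Point),
      ClassO6 W 3 → W.HasSurjectiveModNGaloisRep 3 → W.analyticRank = 1 → W.conductorNorm ℤ = N →
      IsImaginaryQuadratic K → SatisfiesHeegnerHypothesis N K →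
      (W.quadraticTwist (NumberField.discr K : ℚ)).entireLFunction 1 ≠ 0 →
      WeierstrassCurve.Affine.Point.map ι.toRatAlgHom P = heegnerPointComplex Dt H →
      ¬ IsOfFinAddOrder P → Odd (NumberField.discr K) → NumberField.discr K ≠ -3 →
      ∀ (q : ℕ) [Fact q.Prime], q ∣ N →
      ∀ (s' : ℕ), s' ≤ padicValNat 3 ((W.baseChange ℚ_[q]).localTamagawaNumber ℤ_[q]) →
        ∀ (n : ℕ) (d : KolyvaginHeegnerData Dt H.β ι n), Squarefree n →
          (∀ ℓ ∈ n.primeFactors, Zhang2014.IsKolyvaginPrime N W K 3 ℓ ∧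
            s' ≤ Zhang2014.kolyvaginIndex W 3 ℓ) → Koly.PDiv d 3 s')
    (hJb : ∀ (W : WeierstrassCurve ℚ) [W.IsElliptic] [W.IsGloballyMinimal] (N : ℕ) [NeZero N] (K : Type)
      [Field K] [NumberField K] (Dt : ModularParametrizationData W N)
      (H : HeegnerDatum N (NumberField.discr K)) (ι : K →+* ℂ) (P : (W.baseChange K).toAffine.Point),
      ClassO6 W 3 → W.HasSurjectiveModNGaloisRep 3 → W.analyticRank = 1 → W.conductorNorm ℤ = N →
      IsImaginaryQuadratic K → SatisfiesHeegnerHypothesis N K →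
      (W.quadraticTwist (NumberField.discr K : ℚ)).entireLFunction 1 ≠ 0 →
      WeierstrassCurve.Affine.Point.map ι.toRatAlgHom P = heegnerPointComplex Dt H →
      ¬ IsOfFinAddOrder P → Odd (NumberField.discr K) → NumberField.discr K ≠ -3 →
      ∀ (s' : ℕ), (∀ (q : ℕ) [Fact q.Prime], q ∣ N →
        padicValNat 3 ((W.baseChange ℚ_[q]).localTamagawaNumber ℤ_[q]) < s') →
      s' ≤ padicValNat 3 W.tamagawaProduct + padicValNat 3 Dt.c.natAbs →
        ∀ (n : ℕ) (d : KolyvaginHeegnerData Dt H.β ι n), Squarefree n →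
          (∀ ℓ ∈ n.primeFactors, Zhang2014.IsKolyvaginPrime N W K 3 ℓ ∧
            s' ≤ Zhang2014.kolyvaginIndex W 3 ℓ) → Koly.PDiv d 3 s') :
    WildSigmaDivisibilityAtThreeMultiCarrier := by
  intro W _ _ N _ K _ _ Dt H ι P hO6 hsurj hr hN hK hHH hL hP hnt hodd h3 _hmulti s' hs' n d hn hℓ
  by_cases hm : ∀ (q : ℕ) [Fact q.Prime], q ∣ N →
      padicValNat 3 ((W.baseChange ℚ_[q]).localTamagawaNumber ℤ_[q]) < s'
  · exact hJb W N K Dt H ι P hO6 hsurj hr hN hK hHH hL hP hnt hodd h3 s' hm hs' n d hn hℓ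
  · push Not at hm
    obtain ⟨q₀, hq₀, hq₀N, hcar⟩ := hm
    exact hJmax W N K Dt H ι P hO6 hsurj hr hN hK hHH hL hP hnt hodd h3 q₀ hq₀N s' hcar n d hn hℓ

/-- **J‴ ⟹ J⁗, with J‴ BY NAME** (= p606966's `beyondMax_of_sigmaMultiCarrier` read on the route declaration): a depth beyond
every single carrier is `≤ t`, so the frame is multi-carrier. Bookkeeping; CONDITIONAL on J‴; nothing asserted.
[cite: Buyukboduk2009TamagawaDefect, §4.2 Question 1] -/
theorem beyondMax_of_wildSigmaDivisibilityAtThreeMultiCarrier (hJ : WildSigmaDivisibilityAtThreeMultiCarrier) :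
    ∀ (W : WeierstrassCurve ℚ) [W.IsElliptic] [W.IsGloballyMinimal] (N : ℕ) [NeZero N] (K : Type)
      [Field K] [NumberField K] (Dt : ModularParametrizationData W N)
      (H : HeegnerDatum N (NumberField.discr K)) (ι : K →+* ℂ) (P : (W.baseChange K).toAffine.Point),
      ClassO6 W 3 → W.HasSurjectiveModNGaloisRep 3 → W.analyticRank = 1 → W.conductorNorm ℤ = N →
      IsImaginaryQuadratic K → SatisfiesHeegnerHypothesis N K →
      (W.quadraticTwist (NumberField.discr K : ℚ)).entireLFunction 1 ≠ 0 →
      WeierstrassCurve.Affine.Point.map ι.toRatAlgHom P = heegnerPointComplex Dt H →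
      ¬ IsOfFinAddOrder P → Odd (NumberField.discr K) → NumberField.discr K ≠ -3 →
      ∀ (s' : ℕ), (∀ (q : ℕ) [Fact q.Prime], q ∣ N →
        padicValNat 3 ((W.baseChange ℚ_[q]).localTamagawaNumber ℤ_[q]) < s') →
      s' ≤ padicValNat 3 W.tamagawaProduct + padicValNat 3 Dt.c.natAbs →
        ∀ (n : ℕ) (d : KolyvaginHeegnerData Dt H.β ι n), Squarefree n →
          (∀ ℓ ∈ n.primeFactors, Zhang2014.IsKolyvaginPrime N W K 3 ℓ ∧
            s' ≤ Zhang2014.kolyvaginIndex W 3 ℓ) → Koly.PDiv d 3 s' :=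
  beyondMax_of_sigmaMultiCarrier hJ

/-- **J‴ `WildSigmaDivisibilityAtThreeMultiCarrier` (stmt-25898) BY NAME ⟸ {(PT) `poitouTate_selmerStructure_duality_conj`,
(E0) `Gross1991_heegnerPoint_sub_ratTorsion_mem_E0`, (3.7 (2)) `prop37_2_frobeniusCongruence`} + J⁗.** = the first theorem with
`hJmax := jetchevMaxModThree_of_literature hPT hE0 h372` (p606426, w2 g5). So modulo three PRINT facts the crux of record is
the depth residue J⁗ and nothing more. CONDITIONAL on the three named facts and on `hJb` (open research); nothing asserted.
[cite: Jetchev2008, Thm. 1.4 and Conj. 1.3 (p. 812)] [cite: GrossLMS1991, Prop. 3.7 (2)] [cite: Buyukboduk2009TamagawaDefect, §4.2 Question 1] -/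
theorem wildSigmaDivisibilityAtThreeMultiCarrier_of_beyondMax_of_threePrintFacts
    (hPT : ∀ (K : Type) [Field K] [NumberField K], poitouTate_selmerStructure_duality_conj K)
    (hE0 : Gross1991_heegnerPoint_sub_ratTorsion_mem_E0) (h372 : prop37_2_frobeniusCongruence)
    (hJb : ∀ (W : WeierstrassCurve ℚ) [W.IsElliptic] [W.IsGloballyMinimal] (N : ℕ) [NeZero N] (K : Type)
      [Field K] [NumberField K] (Dt : ModularParametrizationData W N)
      (H : HeegnerDatum N (NumberField.discr K)) (ι : K →+* ℂ) (P : (W.baseChange K).toAffine.Point),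
      ClassO6 W 3 → W.HasSurjectiveModNGaloisRep 3 → W.analyticRank = 1 → W.conductorNorm ℤ = N →
      IsImaginaryQuadratic K → SatisfiesHeegnerHypothesis N K →
      (W.quadraticTwist (NumberField.discr K : ℚ)).entireLFunction 1 ≠ 0 →
      WeierstrassCurve.Affine.Point.map ι.toRatAlgHom P = heegnerPointComplex Dt H →
      ¬ IsOfFinAddOrder P → Odd (NumberField.discr K) → NumberField.discr K ≠ -3 →
      ∀ (s' : ℕ), (∀ (q : ℕ) [Fact q.Prime], q ∣ N →
        padicValNat 3 ((W.baseChange ℚ_[q]).localTamagawaNumber ℤ_[q]) < s') →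
      s' ≤ padicValNat 3 W.tamagawaProduct + padicValNat 3 Dt.c.natAbs →
        ∀ (n : ℕ) (d : KolyvaginHeegnerData Dt H.β ι n), Squarefree n →
          (∀ ℓ ∈ n.primeFactors, Zhang2014.IsKolyvaginPrime N W K 3 ℓ ∧
            s' ≤ Zhang2014.kolyvaginIndex W 3 ℓ) → Koly.PDiv d 3 s') :
    WildSigmaDivisibilityAtThreeMultiCarrier :=
  wildSigmaDivisibilityAtThreeMultiCarrier_of_beyondMax_of_jetchevMax (jetchevMaxModThree_of_literature hPT hE0 h372) hJb

/-- **J‴ `WildSigmaDivisibilityAtThreeMultiCarrier` (stmt-25898) BY NAME ⟸ {PT, E0, 3.7 (2)} + J⁗♭ (`hFlatB`: `3^{s′} ∣ P(n)` exactly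
for `max_q ord₃ c_q < s′ ≤ Σ_q ord₃ c_q`, data with `3 ∤ c`) + ManinScaling₃ (`hScal`).** = p606966 §2
(`beyondMax_of_flatBeyondMax_of_maninScaling_of_jetchevMax`, datum scaling) followed by the first theorem, with Jetchev's max
discharged by p606426. So the crux of record splits, in the kernel, as (Büyükboduk 2009 §4.2 Q1 at the additive prime `3`, flat)
⊕ (the `3`-part of Manin's conjecture at `27 ∣ N`) ⊕ print. CONDITIONAL on all five displayed hypotheses; J‴, Manin's conjecture
and BSD stay open. [cite: Jetchev2008, Thm. 1.4 and Conj. 1.3 (p. 812)] [cite: Buyukboduk2009TamagawaDefect, §4.2 Question 1]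
[cite: CesnaviciusNeururerSaha2023, Thm. 1.2] [cite: Darmon2004, Thm. 3.6] -/
theorem wildSigmaDivisibilityAtThreeMultiCarrier_of_flatBeyondMax_of_maninScaling_of_threePrintFacts
    (hPT : ∀ (K : Type) [Field K] [NumberField K], poitouTate_selmerStructure_duality_conj K)
    (hE0 : Gross1991_heegnerPoint_sub_ratTorsion_mem_E0) (h372 : prop37_2_frobeniusCongruence)
    (hFlatB : ∀ (W : WeierstrassCurve ℚ) [W.IsElliptic] [W.IsGloballyMinimal] (N : ℕ) [NeZero N] (K : Type)
      [Field K] [NumberField K] (Dt : ModularParametrizationData W N)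
      (H : HeegnerDatum N (NumberField.discr K)) (ι : K →+* ℂ) (P : (W.baseChange K).toAffine.Point),
      ClassO6 W 3 → W.HasSurjectiveModNGaloisRep 3 → W.analyticRank = 1 → W.conductorNorm ℤ = N →
      IsImaginaryQuadratic K → SatisfiesHeegnerHypothesis N K →
      (W.quadraticTwist (NumberField.discr K : ℚ)).entireLFunction 1 ≠ 0 →
      WeierstrassCurve.Affine.Point.map ι.toRatAlgHom P = heegnerPointComplex Dt H →
      ¬ IsOfFinAddOrder P → Odd (NumberField.discr K) → NumberField.discr K ≠ -3 →
      ¬ (3 : ℤ) ∣ Dt.c →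
      ∀ (s' : ℕ), (∀ (q : ℕ) [Fact q.Prime], q ∣ N →
        padicValNat 3 ((W.baseChange ℚ_[q]).localTamagawaNumber ℤ_[q]) < s') →
      s' ≤ padicValNat 3 W.tamagawaProduct + padicValNat 3 Dt.c.natAbs →
        ∀ (n : ℕ) (d : KolyvaginHeegnerData Dt H.β ι n), Squarefree n →
          (∀ ℓ ∈ n.primeFactors, Zhang2014.IsKolyvaginPrime N W K 3 ℓ ∧
            s' ≤ Zhang2014.kolyvaginIndex W 3 ℓ) → Koly.PDiv d 3 s')
    (hScal : ∀ (W : WeierstrassCurve ℚ) [W.IsElliptic] [W.IsGloballyMinimal] (N : ℕ) [NeZero N],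
      ClassO6 W 3 → W.HasSurjectiveModNGaloisRep 3 → W.analyticRank = 1 → W.conductorNorm ℤ = N →
      ∀ (Dt : ModularParametrizationData W N), ∃ (Dt' : ModularParametrizationData W N) (k : ℤ),
        Dt'.f = Dt.f ∧ Dt'.uniformize = Dt.uniformize ∧ Dt.c = k * Dt'.c ∧ ¬ (3 : ℤ) ∣ Dt'.c) :
    WildSigmaDivisibilityAtThreeMultiCarrier :=
  wildSigmaDivisibilityAtThreeMultiCarrier_of_beyondMax_of_jetchevMax (jetchevMaxModThree_of_literature hPT hE0 h372)
    (beyondMax_of_flatBeyondMax_of_maninScaling_of_jetchevMax (jetchevMaxModThree_of_literature hPT hE0 h372) hFlatB hScal)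

end Summit.BirchSwinnertonDyer.BirchSwinnertonDyer.Theorems.WildSigmaDivisibilityAtThreeMultiCarrierOfBeyondMax

end
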